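import Summits.QuantumFields.YangMills.Theorems.BalabanUVNodesK0AllTorusOfStepTokensGuardedZBLamPrint

/-!
# K0⁷ V23 — THE TWO V23 STUB TEXTS AS TREE DEFINITIONS (print's [II] (2.3) datum `lamDatum F`, print's (7) `dataSmall7LamTopOf F 2`, the ᴮ [15] tokens), THE LOCATED K0–N09
# INTERFACE LETTER `2·a₀ ≤ ε₀·L²` RE-KEYED, AND THE KERNEL DOORS TO K0⁷'s BODY — CONDITIONAL ON THE STAGE-2 SEAM `hseam`, DISPLAYED (pre-seam fileable; green both sides of the seam
# modulo the import closure of `…GuardedZBLamPrint`)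

Cell `pub-ymgap`, PLAN-OWNER seat `pub-ymgap-plan` (gen 96; director-ym №346 (T2 «`K0V23Defs` NEW») ∕ №354 (4) «`K0V23Defs` shape → plan g96∕g97's pen, drafted NOW against §5's name»;
k0-s1-w1 g9 shape word I.33078 (4) + LANDED-6∕-7 ✓p767106 `…GuardedZBLam` ∕ ✓p767248 `…GuardedZBLamPrint`).  `--kind definition --supports stmt-QuantumFields-20541 --as helper`;
count-neutral.  The V23 twin of `…K0V22ZDefs` (ym-nodeO-def-1 g28) and `…K0V20GDefs` (k0-s3-w2): same purpose, same shape, ONE substitution of currency — every [15] token of the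
V22-Z texts `Prop8RegSepTopStepG ∕ VariationalThm1RegSepCoP7MG ∕ Gauge9RegSepTopStepG F 2 … B₃ …` becomes the ᴮ token `…GB F 2 … (lamDatum F) (dataSmall7LamTopOf F 2) B₃ …` (bond datum
= print's [II] (2.3) axial-gauge datum `Λ = ⋃ⱼ Λⱼ(B(Ωⱼ))`, S1a-C `CriticalOnFibreTopGuardedB.lamDatum`; top-domain data = print's (7), P0 `CriticalOnFibreTopGuardedBPrint.dataSmall7LamTopOf`);
the guard `A‴(c, c₀, c₁)`, every binder, every rider, the Z3 member `theta13OfThm1CCMWZB F 2 j (1 / 2) a₀ ε₀ ε₂₉ B₃ B₃' a₀ a₁ (fun _ _ => 0) (fun _ _ => 0)` and the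
sign-free |β| box are BYTE-IDENTICAL to V22-Z (`[YMPLAN-G92-K0V22Z-REGISTERED fe2ecbb43f63b100]`).  WHY V23 (director-ym №338 ∕ №343 (D1) ∕ №346): over print's datum the `bg` row of
`Provisos₁₃SepCoP` needs the background of record to BE the `Λ`-minimiser — node00-def-R's `UbgMSCoPOfRecordB` — which the Stage-2 SEAM edit of `Node00/Record13CoP` (:164–174,
`UbgOfRecord₁₃CoP … (n+1) := UbgMSCoPOfRecordB …`) installs; k0-s1-w1's door ★★★ `K0AllTorusOfStepTokensGuardedZBLam.record13SepCoPHBody_of_stubs1GBPrint_2P_3A'GBPrintZB_lam (hseam) (h1G)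
(h2P) (h3A'G)` (✓p767248) composes K0⁷'s body from the three texts with the seam DISPLAYED as the one hypothesis `hseam` (after the seam edit: `fun _ _ _ _ _ _ => rfl` ∕ `UbgOfRecord₁₃CoP_succ`,
k0-s1-w1's staged `…GuardedZBLamSeam`; before it: NOT provable and NOT claimed).  §1 below puts the two V23 texts into the tree so that Theorems files (n07-e's 140′ `…_of_recordCrown′` for stub 1ᴮ;
NODE O ∕ N26 ∕ the K1 face for 3ᴬ′ᴮ) can spell them BY NAME before and after the V23 skeleton is registered (registration = a ledger act of the plan seat after the seam lands; №281 procedure;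
the skeleton's stubs are stated over THESE defs); §2 re-keys director-ym №288 (2)(c)'s LOCATED-K0ε₀ letter and the strengthened text (V22ZDefs §2 verbatim but for the currency; `K0V22ZDefs` itself
is not importable on the V23 road — it sits on `…GuardedZB`'s (b)-datum closure, red after the seam); §3 gives the kernel doors: strengthened ⟹ V23 text, the letter read off the strengthened
output, and K0⁷'s body from (1ᴮ, the stub-2′ text, 3ᴬ′ᴮ) resp. (1ᴮ, 2′, strengthened) over the door, each CONDITIONAL on `hseam`.
TEXTS (= the door's binders `h1G` ∕ `h3A'G` VERBATIM with print's normalisation letters `Efl`, `logz` at `0` — β is token-blind, DEF-1 `K1ZBWitnessBetaRadius.betaOfRecord₁₃_theta13OfThm1CCMWZB_tokens`,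
`rfl`, displayed again in §3; checked mechanically against `…GuardedZBLamPrint.lean` by the plan's maker `HOME/pub-ymgap-plan/D96-K0V23/mk_k0v23defs.py`).
[15] = [Balaban1985Variational]; [6] = [Balaban1985RegularSpaces]; [II] = [Balaban1984PropagatorsII]; [III] = [Balaban1988Convergent]; [I] = [Balaban1987RG1].

HONEST FRAMING.  Texts and kernel doors only; nothing of Bałaban asserted; every door is CONDITIONAL on the displayed seam hypothesis `hseam` (pre-seam NOT in the tree) and on the stub
texts (CANDIDATES until the plan registers V23 — a re-text is not progress); the LOCATED-K0ε₀ letter is a DISPLAYED HYPOTHESIS, discharged nowhere; no value of `a₀` ∕ `ε₀` ∕ `εbg` chosen;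
K0⁷ V22-Z fe2ecbb43f63b100 «0∕2 (+2′)» OF RECORD until V23 is registered; K0⁷ stub 1 NOT closed; K0⁷ NOT closed; N07 NOT discharged; FLAG №7 (N09) NOT closed; K1⁹ 27364 ∕ K3⁸ 27366 OPEN;
counts UNMOVED (typed 28∕28 · discharged 8∕28, route display 8∕27 excl. NODE O; K 1∕4); R4 = the conditional finite-𝕋⁴ rung `BalabanLadder.UV` at fixed `ε = L^(−K)` only — NOT continuum ∕
ℝ⁴ ∕ OS; the Yang–Mills mass gap (Clay) is NOT proved by any of this.  No `sorry`, no `instance`, no `notation`.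
-/

noncomputable section

open MeasureTheory
open scoped Matrix.Norms.L2Operator

namespace Summit.QuantumFields.YangMills.Theorems.K0V23Defs

open Literature.MathematicalPhysics.QuantumFieldTheory.Balaban1983to89
open Literature.MathematicalPhysics.QuantumFieldTheory.Balaban1983to89.Node00
open Literature.MathematicalPhysics.QuantumFieldTheory.Balaban1983to89.T4Continuum
open Literature.MathematicalPhysics.QuantumFieldTheory.Balaban1983to89.FlowStep
open Literature.MathematicalPhysics.QuantumFieldTheory.Balaban1983to89.B15DeterminingSets
open Literature.MathematicalPhysics.QuantumFieldTheory.Balaban1983to89.B8LeafModelZd (ZdIdx)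
open Summit.QuantumFields.YangMills.Theorems.K0AllTorusOfStepTokensGuardedZBLam (record13SepCoPHBody_of_stubs1GBPrint_2P_3A'GBPrintZB_lam)

/-! ## §1. The two V23 stub texts (the door's `h1G` ∕ `h3A'G` binders verbatim, letters at `0`) -/

/-- **V23 stub 1ᴮ text** `Prop8StepCoPGridGBAt F`: [15] Prop. 8's top step at NODE 00's support domains under the four-conjunct grid guard `A‴(c, c₀, c₁)` (floor `c ≤ ν.M₁` ∧ level guard
`k + c₀ ≤ F.m + K` ∧ granularity `F.L ^ c₁ ∣ M` ∧ torus-compatibility of the `𝐃_i`-partitions), `c c₀ c₁` ∃-bound OUTERMOST, guarded `(B₃, a₀, a₁)` — the V22-Z stub-1 text with the ᴮ token at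
print's datum `(lamDatum F, dataSmall7LamTopOf F 2)`.  NOT registered by this file. [cite: Balaban1985Variational, Prop. 8 p.304, p.304 lines 1–2, (7) p.278; Balaban1984PropagatorsII, (2.3) p.224; Balaban1985RegularSpaces, (1.3)–(1.6) p.77; Balaban1988Convergent, (2.1) p.254, (2.5) p.255, (2.17)–(2.18) p.257; Balaban1987RG1, (0.1) p.251] -/
def Prop8StepCoPGridGBAt (F : T4Family) : Prop :=
  ∃ (c c₀ c₁ : ℕ) (B₃ a₀ a₁ : ℝ), 2 * (F.L : ℝ) ^ 2 ≤ B₃ ∧ 0 < a₀ ∧ 0 < a₁ ∧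
    Prop8RegSepTopStepGB F 2 (fun ν K Ω => suppDomOfRecord F ν K Ω)
      (fun ν M g K k _s => c ≤ ν.M₁ ∧ k + c₀ ≤ F.m + K ∧ F.L ^ c₁ ∣ M ∧
        ∀ i, 1 ≤ i → i ≤ k → dCubeSide (F.P K).L M (RkOfRecord (F.P K).L ν.r (g i)) i ∣ (F.P K).sitesPerDir 0) (lamDatum F) (dataSmall7LamTopOf F 2) B₃ a₀ a₁

/-- **V23 stub 3ᴬ′ᴮ text** `AbsBetaBoxAtThm1WitnessCCMGenGridGZBAt F`: the sign-free |β| box at the LETTER-FREE PRINT-REGIME MEMBER of DEF-1's Z3 family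
`theta13OfThm1CCMWZB F 2 j (1 / 2) a₀ ε₀ ε₂₉ B₃ B₃' a₀ a₁ (fun _ _ => 0) (fun _ _ => 0)` (half window; background radius `εbg := a₀` = the text's own ∀-bound `a₀`) from the grid-guarded ᴮ (8)-sentence and
ᴮ (9)-token at print's datum (same `A‴` as stub 1ᴮ), for every `(j, c, c₀, c₁)` with `c ≤ L^j`, `c₀ ≤ j + 1`, `c₁ ≤ j` — the V22-Z 3ᴬ′-G‴-Z text with the ᴮ tokens; NOTHING else changed.
NOT registered by this file. [cite: Balaban1985Variational, Thm 1 (8),(9) p.279, (7) p.278; Balaban1984PropagatorsII, (2.3) p.224; Balaban1988Convergent, (2.1) p.254, (2.5) p.255, p.257; Balaban1987RG1, (1.12) p.262, (0.21) p.256, (1.6) p.261, (1.20)–(1.22) p.264] -/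
def AbsBetaBoxAtThm1WitnessCCMGenGridGZBAt (F : T4Family) : Prop :=
  ∀ (j c c₀ c₁ : ℕ) (B₃ B₃' a₀ a₁ : ℝ), c ≤ F.L ^ j → c₀ ≤ j + 1 → c₁ ≤ j → 2 * (F.L : ℝ) ^ 2 ≤ B₃ → 0 < B₃' → 0 < a₀ → 0 < a₁ →
    VariationalThm1RegSepCoP7MGB F 2
      (fun ν M g K k _s => c ≤ ν.M₁ ∧ k + c₀ ≤ F.m + K ∧ F.L ^ c₁ ∣ M ∧
        ∀ i, 1 ≤ i → i ≤ k → dCubeSide (F.P K).L M (RkOfRecord (F.P K).L ν.r (g i)) i ∣ (F.P K).sitesPerDir 0) (lamDatum F) (dataSmall7LamTopOf F 2) B₃ a₀ a₁ →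
    Gauge9RegSepTopStepGB F 2 (fun ν K Ω => suppDomOfRecord F ν K Ω) (F.L ^ j)
      (fun ν M g K k _s => c ≤ ν.M₁ ∧ k + c₀ ≤ F.m + K ∧ F.L ^ c₁ ∣ M ∧
        ∀ i, 1 ≤ i → i ≤ k → dCubeSide (F.P K).L M (RkOfRecord (F.P K).L ν.r (g i)) i ∣ (F.P K).sitesPerDir 0) (lamDatum F) (dataSmall7LamTopOf F 2) B₃ B₃' a₀ a₁ →
    ∃ γ₀ ε₀ ε₂₉ β' : ℝ, 0 < γ₀ ∧ 0 < ε₀ ∧ 0 < ε₂₉ ∧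
      BetaLowerH (-β') γ₀ (betaOfRecord₁₃ F 2 (theta13OfThm1CCMWZB F 2 j (1 / 2) a₀ ε₀ ε₂₉ B₃ B₃' a₀ a₁ (fun _ _ => 0) (fun _ _ => 0))) ∧
      BetaUpperH β' γ₀ (betaOfRecord₁₃ F 2 (theta13OfThm1CCMWZB F 2 j (1 / 2) a₀ ε₀ ε₂₉ B₃ B₃' a₀ a₁ (fun _ _ => 0) (fun _ _ => 0)))

/-! ## §2. LOCATED-K0ε₀ (director-ym №288 (2)(c)) re-keyed: the K0–N09 interface letter and the strengthened 3ᴬ′ᴮ text carrying it on stub 3's OWN output -/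

/-- **THE K0–N09 INTERFACE LETTER AT THE Z3 MEMBER, BY NAME** — `2·a₀ ≤ ε₀·L²` (= `K0V22ZDefs.K0N09Eps0LetterAt` VERBATIM; restated under this namespace because `…K0V22ZDefs` sits on the
(b)-datum closure and is not importable on the V23 road).  A DISPLAYED HYPOTHESIS on stub 3ᴬ′ᴮ's ∃-output `ε₀`; in print `ε₀ = ε₀(d, L)` ([I] Thm 1), so the row holds there as `a₀ ↓ 0`; as typed
it is nobody's theorem and is NEVER to be discharged by a numerics pin. [cite: Balaban1987RG1, Thm 1 p.259, (0.21) p.256, (1.2) p.260; Balaban1985Variational, Thm 1 (8) p.279] -/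
def K0N09Eps0LetterAt (F : T4Family) (a₀ ε₀ : ℝ) : Prop :=
  2 * a₀ ≤ ε₀ * (F.L : ℝ) ^ 2

/-- **THE STRENGTHENED 3ᴬ′ᴮ TEXT «WITH LOCATED-K0ε₀»**: §1's 3ᴬ′ᴮ text with the letter `K0N09Eps0LetterAt F a₀ ε₀` CONJOINED TO THE ∃-OUTPUT (after the three signs), every other byte
identical (= `K0V22ZDefs.AbsBetaBoxAtThm1WitnessCCMGenGridGZEps0At` with the ᴮ tokens).  NOT registered; NOT asserted. [cite: Balaban1985Variational, Thm 1 (8),(9) p.279; Balaban1987RG1, Thm 1 p.259, (1.2) p.260, (1.20)–(1.22) p.264; Balaban1988Convergent, (2.1) p.254, (2.5) p.255] -/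
def AbsBetaBoxAtThm1WitnessCCMGenGridGZBEps0At (F : T4Family) : Prop :=
  ∀ (j c c₀ c₁ : ℕ) (B₃ B₃' a₀ a₁ : ℝ), c ≤ F.L ^ j → c₀ ≤ j + 1 → c₁ ≤ j → 2 * (F.L : ℝ) ^ 2 ≤ B₃ → 0 < B₃' → 0 < a₀ → 0 < a₁ →
    VariationalThm1RegSepCoP7MGB F 2
      (fun ν M g K k _s => c ≤ ν.M₁ ∧ k + c₀ ≤ F.m + K ∧ F.L ^ c₁ ∣ M ∧
        ∀ i, 1 ≤ i → i ≤ k → dCubeSide (F.P K).L M (RkOfRecord (F.P K).L ν.r (g i)) i ∣ (F.P K).sitesPerDir 0) (lamDatum F) (dataSmall7LamTopOf F 2) B₃ a₀ a₁ →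
    Gauge9RegSepTopStepGB F 2 (fun ν K Ω => suppDomOfRecord F ν K Ω) (F.L ^ j)
      (fun ν M g K k _s => c ≤ ν.M₁ ∧ k + c₀ ≤ F.m + K ∧ F.L ^ c₁ ∣ M ∧
        ∀ i, 1 ≤ i → i ≤ k → dCubeSide (F.P K).L M (RkOfRecord (F.P K).L ν.r (g i)) i ∣ (F.P K).sitesPerDir 0) (lamDatum F) (dataSmall7LamTopOf F 2) B₃ B₃' a₀ a₁ →
    ∃ γ₀ ε₀ ε₂₉ β' : ℝ, 0 < γ₀ ∧ 0 < ε₀ ∧ 0 < ε₂₉ ∧ K0N09Eps0LetterAt F a₀ ε₀ ∧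
      BetaLowerH (-β') γ₀ (betaOfRecord₁₃ F 2 (theta13OfThm1CCMWZB F 2 j (1 / 2) a₀ ε₀ ε₂₉ B₃ B₃' a₀ a₁ (fun _ _ => 0) (fun _ _ => 0))) ∧
      BetaUpperH β' γ₀ (betaOfRecord₁₃ F 2 (theta13OfThm1CCMWZB F 2 j (1 / 2) a₀ ε₀ ε₂₉ B₃ B₃' a₀ a₁ (fun _ _ => 0) (fun _ _ => 0)))

/-! ## §3. Kernel doors (displayed, count-neutral; every door to K0⁷'s body is CONDITIONAL on the Stage-2 seam `hseam`) -/

/-- The strengthened text implies the V23 text at `F` (drop the letter). [cite: Balaban1987RG1, §1 p.264 (bookkeeping)] -/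
theorem absBetaBoxGenGridGZBAt_of_eps0 (F : T4Family) (h : AbsBetaBoxAtThm1WitnessCCMGenGridGZBEps0At F) : AbsBetaBoxAtThm1WitnessCCMGenGridGZBAt F :=
  fun j c c₀ c₁ B₃ B₃' a₀ a₁ hc hc₀ hc₁ hB₃ hB₃' ha₀ ha₁ h15 h9 => by
    obtain ⟨γ₀, ε₀, ε₂₉, β', hγ₀, hε₀, hε₂₉, -, hlow, hup⟩ := h j c c₀ c₁ B₃ B₃' a₀ a₁ hc hc₀ hc₁ hB₃ hB₃' ha₀ ha₁ h15 h9
    exact ⟨γ₀, ε₀, ε₂₉, β', hγ₀, hε₀, hε₂₉, hlow, hup⟩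

/-- The letter READ OFF the strengthened output at a door (the form the N24 engine consumes at its chosen `(j, c, c₀, c₁; B₃, B₃', a₀, a₁)`). [cite: Balaban1987RG1, Thm 1 p.259, (1.2) p.260 (bookkeeping)] -/
theorem exists_eps0Letter_absBox_of_eps0B (F : T4Family) (h : AbsBetaBoxAtThm1WitnessCCMGenGridGZBEps0At F) (j c c₀ c₁ : ℕ) (B₃ B₃' a₀ a₁ : ℝ)
    (hc : c ≤ F.L ^ j) (hc₀ : c₀ ≤ j + 1) (hc₁ : c₁ ≤ j) (hB₃ : 2 * (F.L : ℝ) ^ 2 ≤ B₃) (hB₃' : 0 < B₃') (ha₀ : 0 < a₀) (ha₁ : 0 < a₁)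
    (h15 : VariationalThm1RegSepCoP7MGB F 2
      (fun ν M g K k _s => c ≤ ν.M₁ ∧ k + c₀ ≤ F.m + K ∧ F.L ^ c₁ ∣ M ∧
        ∀ i, 1 ≤ i → i ≤ k → dCubeSide (F.P K).L M (RkOfRecord (F.P K).L ν.r (g i)) i ∣ (F.P K).sitesPerDir 0) (lamDatum F) (dataSmall7LamTopOf F 2) B₃ a₀ a₁)
    (h9 : Gauge9RegSepTopStepGB F 2 (fun ν K Ω => suppDomOfRecord F ν K Ω) (F.L ^ j)
      (fun ν M g K k _s => c ≤ ν.M₁ ∧ k + c₀ ≤ F.m + K ∧ F.L ^ c₁ ∣ M ∧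
        ∀ i, 1 ≤ i → i ≤ k → dCubeSide (F.P K).L M (RkOfRecord (F.P K).L ν.r (g i)) i ∣ (F.P K).sitesPerDir 0) (lamDatum F) (dataSmall7LamTopOf F 2) B₃ B₃' a₀ a₁) :
    ∃ γ₀ ε₀ ε₂₉ β' : ℝ, 0 < γ₀ ∧ 0 < ε₀ ∧ 0 < ε₂₉ ∧ 2 * a₀ ≤ ε₀ * (F.L : ℝ) ^ 2 ∧
      BetaLowerH (-β') γ₀ (betaOfRecord₁₃ F 2 (theta13OfThm1CCMWZB F 2 j (1 / 2) a₀ ε₀ ε₂₉ B₃ B₃' a₀ a₁ (fun _ _ => 0) (fun _ _ => 0))) ∧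
      BetaUpperH β' γ₀ (betaOfRecord₁₃ F 2 (theta13OfThm1CCMWZB F 2 j (1 / 2) a₀ ε₀ ε₂₉ B₃ B₃' a₀ a₁ (fun _ _ => 0) (fun _ _ => 0))) :=
  h j c c₀ c₁ B₃ B₃' a₀ a₁ hc hc₀ hc₁ hB₃ hB₃' ha₀ ha₁ h15 h9

/-- 3ᴬ′ᴮ display (kernel, `rfl`; DEF-1's `K1ZBWitnessBetaRadius.betaOfRecord₁₃_theta13OfThm1CCMWZB_tokens` at `N = 2`, restated without the import): the β the letter-free text boxes IS
the β of the member at ANY letters `(Efl, logz)` — so the door's section letters unify with the letter-free texts. [cite: Balaban1987RG1, (1.6) p.261, (1.20)–(1.22) p.264 (bookkeeping)] -/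
example (F : T4Family) (j : ℕ) (ε₀ ε₂₉ B₃ B₃' a₀ a₁ : ℝ) (Efl logz : B12.RunParams → ℕ → ℝ) :
    betaOfRecord₁₃ F 2 (theta13OfThm1CCMWZB F 2 j (1 / 2) a₀ ε₀ ε₂₉ B₃ B₃' a₀ a₁ (fun _ _ => 0) (fun _ _ => 0)) =
      betaOfRecord₁₃ F 2 (theta13OfThm1CCMWZB F 2 j (1 / 2) a₀ ε₀ ε₂₉ B₃ B₃' a₀ a₁ Efl logz) := rfl

/-- **★ K0⁷'s BODY AT EVERY FAMILY from the V23 stub-1ᴮ text, the stub-2′ text and the V23 3ᴬ′ᴮ text, CONDITIONAL ON THE SEAM** — k0-s1-w1's door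
`record13SepCoPHBody_of_stubs1GBPrint_2P_3A'GBPrintZB_lam` (✓p767248) with its section letters at the letter-free member; `hseam` = the Stage-2 seam DISPLAYED (post-seam: `fun _ _ _ _ _ _ => rfl`).
The shape the V23 skeleton's `Record13SepCoPHInhabited_of h1 h3` instantiates (stub 2′'s landed sentence fills `h2P`; the seam one-liner fills `hseam`).  CONDITIONAL; K0⁷ NOT closed; nothing
of Bałaban asserted. [cite: Balaban1985Variational, Thm 1 (8)–(9) p.279, (7) p.278, Prop. 8 p.304; Balaban1985RegularSpaces, Prop. 6 p.99; Balaban1984PropagatorsII, (2.3) p.224; Balaban1988Convergent, Thm 1 p.262, (2.1) p.254, (2.12)–(2.13) pp.256–257; Balaban1987RG1, Thm 1 p.259, (0.1) p.251] -/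
theorem k0Body_of_stub1B_of_2P_of_3B
    (hseam : ∀ (F : T4Family) (θ : Stage13Params F 2) (p : B12.RunParams) (n : ℕ) (s : SeqOfRecord F θ.ν θ.τ9.M (gOfRecord₁₃ F 2 θ p) p.K (n + 1)) (W : MSField (F.P p.K) (SU 2)),
      UbgOfRecord₁₃CoP F 2 θ p (n + 1) s W = UbgMSCoPOfRecordB F 2 θ.ν θ.τ9.M (gOfRecord₁₃ F 2 θ p) p.K (n + 1) s W)
    (h1 : ∀ F : T4Family, Prop8StepCoPGridGBAt F)
    (h2P : ∀ F : T4Family, ∃ (ρ₀ : ℕ) (B₁ c₁ : ℝ), 1 ≤ ρ₀ ∧ 0 ≤ B₁ ∧ 0 < c₁ ∧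
      (letI : CStarAlgebra (MatA 2) := {}; B8.Prop6Printed 4 (F.L : ℝ) B₁ c₁ (fun i : ZdIdx 4 F.L => zdCubP (MatA 2) F.L ρ₀ i)))
    (h3 : ∀ F : T4Family, AbsBetaBoxAtThm1WitnessCCMGenGridGZBAt F) :
    ∀ F : T4Family, ∃ θ : Stage13HParams F 2, θ.Provisos₁₃SepCoPH F 2 ∧ (θ.ZhUnity F 2 ∧ θ.SlotsNondegenerate₁₃ F 2) ∧ θ.Admissible F 2 :=
  record13SepCoPHBody_of_stubs1GBPrint_2P_3A'GBPrintZB_lam hseam h1 h2P h3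

/-- **K0⁷'s BODY AT EVERY FAMILY from the V23 stub-1ᴮ text, the stub-2′ text and the STRENGTHENED 3ᴬ′ᴮ text, CONDITIONAL ON THE SEAM** (through `absBetaBoxGenGridGZBAt_of_eps0`): a
by-name proof of the stronger text composes K0⁷'s body exactly as the V23 text does.  CONDITIONAL; K0⁷ NOT closed; nothing of Bałaban asserted. [cite: Balaban1985Variational, Thm 1 (8)–(9) p.279, Prop. 8 p.304; Balaban1985RegularSpaces, Prop. 6 p.99; Balaban1988Convergent, Thm 1 p.262, (2.1) p.254; Balaban1987RG1, Thm 1 p.259, (0.1) p.251] -/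
theorem k0Body_of_stub1B_of_2P_of_eps0B
    (hseam : ∀ (F : T4Family) (θ : Stage13Params F 2) (p : B12.RunParams) (n : ℕ) (s : SeqOfRecord F θ.ν θ.τ9.M (gOfRecord₁₃ F 2 θ p) p.K (n + 1)) (W : MSField (F.P p.K) (SU 2)),
      UbgOfRecord₁₃CoP F 2 θ p (n + 1) s W = UbgMSCoPOfRecordB F 2 θ.ν θ.τ9.M (gOfRecord₁₃ F 2 θ p) p.K (n + 1) s W)
    (h1 : ∀ F : T4Family, Prop8StepCoPGridGBAt F)
    (h2P : ∀ F : T4Family, ∃ (ρ₀ : ℕ) (B₁ c₁ : ℝ), 1 ≤ ρ₀ ∧ 0 ≤ B₁ ∧ 0 < c₁ ∧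
      (letI : CStarAlgebra (MatA 2) := {}; B8.Prop6Printed 4 (F.L : ℝ) B₁ c₁ (fun i : ZdIdx 4 F.L => zdCubP (MatA 2) F.L ρ₀ i)))
    (h3e : ∀ F : T4Family, AbsBetaBoxAtThm1WitnessCCMGenGridGZBEps0At F) :
    ∀ F : T4Family, ∃ θ : Stage13HParams F 2, θ.Provisos₁₃SepCoPH F 2 ∧ (θ.ZhUnity F 2 ∧ θ.SlotsNondegenerate₁₃ F 2) ∧ θ.Admissible F 2 :=
  k0Body_of_stub1B_of_2P_of_3B hseam h1 h2P fun F => absBetaBoxGenGridGZBAt_of_eps0 F (h3e F)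

end Summit.QuantumFields.YangMills.Theorems.K0V23Defs

end
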